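import Literature.NumberTheory.Sieve.JurkatRichertLinearSieveLower
import HarnessLib

/-!
# The Jurkat–Richert upper bound in Nathanson's explicit form (Theorem 9.7 (9.35) with Theorem 9.8)

Topic `Literature/NumberTheory/Sieve`; the UPPER-BOUND companion of
`JurkatRichertLinearSieveLower.lean`, closing the series of files on the explicit form of the
Jurkat–Richert theorem following M. B. Nathanson, *Additive Number Theory: The Classical Bases*,
GTM 164 (1996), Ch. 9 (PDF pp. 144–165 of the held copy) [Nathanson1996]:
`JurkatRichertPartialSummation.lean` (Lemma 9.8), `JurkatRichertMajorants.lean`,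
`JurkatRichertContinuous.lean` (Lemmas 9.6–9.7), `JurkatRichertInduction.lean` (Theorem 9.5 and
Theorem 9.6 upper with Theorem 9.8: `JurkatRichert.mainSum_one_le`, under `JurkatRichert.KCond`),
`JurkatRichertCompositeSieve.lean` (Lemma 9.1 / Theorem 9.2 for the upper weights:
`SieveSequence.sifted_le_compositeSieve`) and `JurkatRichertLinearSieveLower.lean` (the lower
halves, the restricted density `JurkatRichert.restrict` with `kCond_restrict`, `mainSum_restrict`,
`vprod_restrict_primesProdBelow`, the all-levels hypothesis
`SieveSequence.HasMertensHypothesisBelow`, and the corrected lower-bound fact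
`LinearSieve.jurkatRichert_lower_allLevels` with its discharge).

Here the upper bound is assembled: the named fact `LinearSieve.jurkatRichert_upper_allLevels` and
its discharge `jurkatRichert_upper_allLevels_holds`.

## The statement proved, and why it differs from `jurkatRichert_upper`

Exactly as for the lower bound (see the module docstring of `JurkatRichertLinearSieveLower.lean`):
the vendored `LinearSieve.jurkatRichert_upper` (`JurkatRichertLinearSieve.lean`) transcribes
hypothesis (9.34) as `SieveSequence.HasMertensHypothesis A P Q ε z`, i.e. ONLY AT THE TOP SIEVING
LEVEL `z` — which is how Theorem 9.7 prints it ("for all `n` and `1 < u < z`") — whereas Nathanson's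
proof of Theorem 9.7 goes through Theorem 9.6 and the induction of Theorem 9.5, which applies the
induction hypothesis, and with it Lemma 9.8 and condition (9.29), at every sieving level `p < z` of
the recursion (9.14)–(9.15) (`JurkatRichert.KCond`); §9.4 makes (9.29) a standing assumption and
Ch. 10 (pp. 169–170) verifies (9.34) at all levels. The level-`z` inequality only yields
`∏_{u ≤ q < p} (1 − g(q))⁻¹ ≤ K log z/log u`, not `≤ K log p/log u`. Whether the single-level statement
is true is not known to us; it is not the theorem the source proves. We therefore vendor the
corrected statement `LinearSieve.jurkatRichert_upper_allLevels`, identical to `jurkatRichert_upper`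
except that (9.34) is required at all levels `w ≤ z` (`SieveSequence.HasMertensHypothesisBelow`), and
PROVE it; `jurkatRichert_upper_allLevels_of_upper` records that the vendored fact implies the
corrected one. The single-level fact `jurkatRichert_upper` is left untouched and undischarged; since
2026-08-15 (defact verdict clean-up) it is `@[deprecated]` in `JurkatRichertLinearSieve.lean` in
favour of `jurkatRichert_upper_allLevels`, and the bridge `jurkatRichert_upper_allLevels_of_upper`,
whose hypothesis it is, is deprecated with it (kept as the machine-checked record that the
correction only adds a hypothesis).

## Proof (Nathanson p. 161 with the tree's explicit sieve)

Write `P = P₁ ∏_{q ∈ 𝒬} q` with `P₁ = ∏_{p ∣ P, p ∉ 𝒬} p`. Theorem 9.2 for the composite upper weights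
(`SieveSequence.sifted_le_compositeSieve`) gives
`S(𝒜, P; x) ≤ X · G(λ₁⁺) ∏_{q ∈ 𝒬} (1 − g(q)) + ∑_{d ∣ P, d < DQ} |R_d(x)|`,
`G(λ₁⁺) = BetaSieve.mainSum 1 g 2 D P₁`; Theorem 9.6 at the restricted density
(`JurkatRichert.mainSum_one_le` with `kCond_restrict`, `mainSum_restrict`,
`vprod_restrict_primesProdBelow`) gives `G(λ₁⁺) ≤ V(P₁)(2e^γ/s + ε e^{14−s})` for `1 ≤ s ≤ 3`, and
`V(P₁) ∏_{q ∈ 𝒬} (1 − g(q)) = V(P)` ((9.38)).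

## References

* M. B. Nathanson, *Additive Number Theory: The Classical Bases*, GTM 164, Springer (1996), §9.1
  Theorem 9.1, Lemma 9.1, Theorem 9.2, §9.4 Theorems 9.5–9.7, §9.5 Theorem 9.8; Ch. 10,
  pp. 169–170. [Nathanson1996]
* W. B. Jurkat, H.-E. Richert, *An improvement of Selberg's sieve method I*, Acta Arith. 11
  (1965), 217–240. [JurkatRichertActaArith1965]
-/

open Finset Real
open scoped ArithmeticFunction.Moebius ArithmeticFunction.omega

noncomputable section

namespace Literature.NumberTheory.Sieve

namespace LinearSieve

open BetaSieve JurkatRichert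

/-- **Jurkat–Richert theorem, upper bound, with `F(s) = 2e^γ/s`, hypothesis (9.34) at all levels**
(Nathanson, *Additive Number Theory*, Thm 9.7 (9.35) with Thm 9.8; Jurkat–Richert 1965). Identical
to `jurkatRichert_upper` except that the Mertens-type hypothesis (9.34) is required at every sieving
level `w ≤ z` (`SieveSequence.HasMertensHypothesisBelow`) instead of at `w = z` only
(`SieveSequence.HasMertensHypothesis`): this is the hypothesis actually used by Nathanson's proof
(induction over the levels `p < z` in Thm 9.5) and verified in his application (Ch. 10, pp. 169–170);
see the module docstring. For a sifted sequence `A` (weights `a(n) ≥ 0`, multiplicative density `g`)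
with `X(x) = ∑_{n ≤ x} a(n) = |A|`, squarefree `P ∣ P(z)` with `0 ≤ g(p) < 1` for `p ∣ P`, `𝒬` a set of
prime factors of `P` with product `Q`, `0 < ε < 1/200`, `z ≥ 2`, `D ≥ z` with `s = log D/log z ≤ 3`:
`S(A, P; x) ≤ (2e^γ/s + εe^{14−s}) V(P)|A| + ∑_{d ∣ P, d < DQ} |r(d)|`.
PROVED: `jurkatRichert_upper_allLevels_holds`. [cite: Nathanson1996, Thm 9.7 (9.35) and Thm 9.8] -/
def jurkatRichert_upper_allLevels : Prop :=
  ∀ (A : SieveSequence) (x : ℝ) (P : ℕ) (Q : Finset ℕ) (ε z D : ℝ),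
    Squarefree P → P ∣ primesProdBelow z →
    (∀ p ∈ P.primeFactors, 0 ≤ A.density p ∧ A.density p < 1) → Q ⊆ P.primeFactors →
    0 < ε → ε < 1 / 200 → 2 ≤ z → z ≤ D → Real.log D / Real.log z ≤ 3 →
    A.size x = ∑ n ∈ Ioc 0 ⌊x⌋₊, A.a n → A.HasMertensHypothesisBelow P Q ε z →
      A.sifted x P ≤
        (2 * Real.exp Real.eulerMascheroniConstant / (Real.log D / Real.log z) +
              ε * Real.exp (14 - Real.log D / Real.log z)) *
            (A.densityProduct P * A.size x) +
          ∑ d ∈ P.divisors.filter (fun d : ℕ => (d : ℝ) < D * ∏ q ∈ Q, (q : ℝ)), |A.remainder d x|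

/-- **Deprecated (2026-08-15) together with its hypothesis**, the single-level fact
`jurkatRichert_upper` (`JurkatRichertLinearSieve.lean`, mis-stated relative to the source's proof):
use `jurkatRichert_upper_allLevels` / `jurkatRichert_upper_allLevels_holds` directly. *Content
(unchanged):* the vendored single-level fact implies the corrected one (its hypothesis (9.34) at
level `z` is the instance `w = z` of the all-levels hypothesis), i.e. the correction only adds a
hypothesis — kept as the machine-checked record of that. [folklore] -/
@[deprecated "deprecated with its hypothesis LinearSieve.jurkatRichert_upper (mis-stated): use Literature.NumberTheory.Sieve.LinearSieve.jurkatRichert_upper_allLevels_holds" (since := "2026-08-15")]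
theorem jurkatRichert_upper_allLevels_of_upper (h : jurkatRichert_upper) :
    jurkatRichert_upper_allLevels :=
  fun A x P Q ε z D hP hPz h01 hQ hε hε' hz hzD hs hX hM =>
    h A x P Q ε z D hP hPz h01 hQ hε hε' hz hzD hs hX (hM.hasMertensHypothesis hPz)

/-- **Nathanson's Theorem 9.7, upper bound (9.35), with `F(s) = 2e^γ/s` from Theorem 9.8, PROVED**
in the corrected form `jurkatRichert_upper_allLevels` (hypothesis (9.34) at all levels; see the
module docstring). Proof as printed (p. 161): the upper-bound sieve `λ⁺` of Theorem 9.3 (`β = 2`) on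
`𝒫₁ = 𝒫 ∖ 𝒬` extended by `𝒬` (Lemma 9.1), the basic inequality with `|λ⁺| ≤ 1` and support level
`DQ` (Theorem 9.2, `SieveSequence.sifted_le_compositeSieve`), Theorem 9.6 for `G(z, λ₁⁺)`
(`JurkatRichert.mainSum_one_le`, applied to the density restricted to `𝒫₁`), and (9.38).
[cite: Nathanson1996, Thm 9.7 (9.35) and Thm 9.8] -/
theorem jurkatRichert_upper_allLevels_holds : jurkatRichert_upper_allLevels := by
  intro A x P Q ε z D hP hPz h01 hQ hε hε' hz hzD hs3 hsize hM
  classical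
  set g := A.density with hg
  set S := P.primeFactors with hS
  set P₁ := ∏ p ∈ S \ Q, p with hP₁
  set s := Real.log D / Real.log z with hs
  set coef := 2 * Real.exp Real.eulerMascheroniConstant / s + ε * Real.exp (14 - s) with hcoef
  set R := ∑ d ∈ P.divisors.filter (fun d : ℕ => (d : ℝ) < D * ∏ q ∈ Q, (q : ℝ)), |A.remainder d x|
    with hR
  have hz1 : 1 < z := by linarith
  have hD1 : 1 < D := by linarith
  have hprimeS : ∀ p ∈ S, p.Prime := fun p hp => Nat.prime_of_mem_primeFactors hp
  have hSz : ∀ p ∈ S, (p : ℝ) < z := fun p hp => prime_lt_of_mem_primeFactors_of_dvd hPz hp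
  -- `P = P₁ ∏ Q`
  have hPprod : P₁ * ∏ q ∈ Q, q = P := by
    rw [hP₁, Finset.prod_sdiff hQ, Nat.prod_primeFactors_of_squarefree hP]
  have hP₁S : P₁.primeFactors = S \ Q :=
    Nat.primeFactors_prod fun p hp => hprimeS p (Finset.mem_sdiff.mp hp).1
  have hPsq : Squarefree (P₁ * ∏ q ∈ Q, q) := by rw [hPprod]; exact hP
  have hP₁sq : Squarefree P₁ := hPsq.squarefree_of_dvd (dvd_mul_right _ _)
  have hP₁0 : P₁ ≠ 0 := hP₁sq.ne_zero
  have hP₁z : P₁ ∣ primesProdBelow z := (Dvd.intro _ hPprod).trans hPz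
  have hQ' : ∀ q ∈ Q, q.Prime ∧ ¬ q ∣ P₁ := fun q hq =>
    ⟨hprimeS q (hQ hq), fun hd => by
      have hmem := Nat.mem_primeFactors.mpr ⟨hprimeS q (hQ hq), hd, hP₁0⟩
      rw [hP₁S] at hmem
      exact (Finset.mem_sdiff.mp hmem).2 hq⟩
  have h01₁ : ∀ p ∈ P₁.primeFactors, 0 ≤ g p ∧ g p < 1 := fun p hp =>
    h01 p (by rw [hP₁S] at hp; exact (Finset.mem_sdiff.mp hp).1)
  have hP₁lt : ∀ p ∈ P₁.primeFactors, (p : ℝ) < z := fun p hp =>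
    hSz p (by rw [hP₁S] at hp; exact (Finset.mem_sdiff.mp hp).1)
  -- Theorem 9.6 (upper) for the restricted density
  have hKC : KCond (restrict g P₁) (1 + ε) z := by
    refine kCond_restrict hP₁0 fun u w hu huw hwz => ?_
    rw [hP₁S]
    exact (hM u w hu huw hwz).le
  have hMT := mainSum_one_le (isMultiplicative_restrict A.density_mult P₁)
    (K := 1 + ε) (by linarith) (by linarith) hKC (restrict_prime hP₁0 h01₁ z) hz hzD hs3
  rw [mainSum_restrict hP₁z, vprod_restrict_primesProdBelow hP₁0,
    Finset.filter_true_of_mem hP₁lt, ← hg, ← hs, add_sub_cancel_left, ← hcoef] at hMT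
  -- Theorem 9.2 (upper) with the composite weights
  have hSv := A.sifted_le_compositeSieve (D := D) hP₁sq hP₁lt hD1 hzD Q hQ' hPsq x
  rw [hPprod, ← hg, ← hR] at hSv
  -- signs and the factorisation of `V(P)` ((9.38))
  have hX0 : 0 ≤ A.size x := by rw [hsize]; exact Finset.sum_nonneg fun n _ => A.a_nonneg n
  have hQprod0 : 0 ≤ ∏ q ∈ Q, (1 - g q) :=
    Finset.prod_nonneg fun q hq => (sub_pos.mpr (h01 q (hQ hq)).2).le
  have hdens : A.densityProduct P = (∏ p ∈ P₁.primeFactors, (1 - g p)) * ∏ q ∈ Q, (1 - g q) := by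
    rw [SieveSequence.densityProduct, hP₁S, ← hS, Finset.prod_sdiff hQ]
  show A.sifted x P ≤ coef * (A.densityProduct P * A.size x) + R
  have h1 : A.size x * (mainSum 1 g 2 D P₁ * ∏ q ∈ Q, (1 - g q)) ≤
      coef * (A.densityProduct P * A.size x) := by
    rw [hdens]
    have := mul_le_mul_of_nonneg_left (mul_le_mul_of_nonneg_right hMT hQprod0) hX0
    nlinarith
  linarith

end LinearSieve

end Literature.NumberTheory.Sieve
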